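import Summits.ValiantsHypothesis.ValiantsHypothesis.Theorems.BinomialElusiveBinomialCandidateJetReductionIteration

/-!
# Crux `BinomialElusive.BinomialCandidate` (stmt-ValiantsHypothesis-7392), line `registered` —
# stub `stub_jetReduction`, part 3/4: source coordinates at an immersive base point

Abstract setting (part 1): a commutative `R`-algebra `A` with a decreasing multiplicative
filtration `F : ℕ → A → Prop` such that level `1` contains no nonzero constant.  Data: a
quadratic map `Γ : R^k → R^{k+1}` (polynomials of total degree `≤ 2` in `k` variables), a
solution `p` of `Γ(p) = T` with `p ≡ y₀` and `T ≡ 0` to level `1`, an output `i₀` and a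
two-sided inverse `M` of the Jacobian minor `J' = (∂_j Γ_i(y₀))_{i ≠ i₀, j}`.

`jetReduction_coordinates` produces the input of the iteration theorem of part 2: in the source
coordinates `y = y₀ + M w` one has `Γ_i(y₀ + M w) = w_{i'} + B_{i'}(w)` for `i = i₀.succAbove i'`
and `Γ_{i₀}(y₀ + M w) = ℓ(w) + B₀(w)` with `B, B₀` without monomials of degree `< 2`
(affine Taylor expansion `affineTaylor` — proved on `C a`, sums and `p * X n`, no calculus —
plus `Γ(y₀) = 0`, read off to level `1`), so that `q̃ := J'(p - y₀)` solves `q̃ = T' - B(q̃)` and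
`T_{i₀} = ℓ(q̃) + B₀(q̃)`; moreover `ℓ = 0` and `B₀ ≡ 0 (mod degree ≥ 3)` force `B₀ = 0`
(total degree `≤ 2`, `totalDegree_aeval_le_of_le_one`) hence `T_{i₀} = Γ_{i₀}(p) = 0`.
`jetReduction_coordinatesLaurent` is the instance `A = ℂ((t))` used by part 4.
-/

-- layout Summits/ValiantsHypothesis/ValiantsHypothesis forces the duplicated namespace component
set_option linter.dupNamespace false

namespace Summit.ValiantsHypothesis.ValiantsHypothesis.Theorems.BinomialCandidateStubs

open scoped BigOperators
open MvPolynomial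

namespace JetReduction

/-! ## Two more closure facts -/

section Filtration

variable {R A : Type*} [CommRing R] [CommRing A] [Algebra R A] {F : ℕ → A → Prop}
  (hF : (∀ n, F n 0) ∧ (∀ n x y, F n x → F n y → F n (x + y)) ∧ (∀ n x, F n x → F n (-x)) ∧
    (∀ a b x, a ≤ b → F b x → F a x) ∧ (∀ r, F 0 (algebraMap R A r)) ∧
    (∀ a b x y, F a x → F b y → F (a + b) (x * y)))
include hF

/-- Levels are closed under subtraction. -/
theorem filt_sub {n : ℕ} {x y : A} (hx : F n x) (hy : F n y) : F n (x - y) := by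
  rw [sub_eq_add_neg]; exact hF.2.1 n x _ hx (hF.2.2.1 n y hy)

end Filtration

/-! ## Affine substitutions -/

section Subst

variable {σ τ R : Type*} [CommRing R]

/-- Products gain degrees. -/
theorem degGE_mul {a b : ℕ} {f g : MvPolynomial σ R} (hf : ∀ d : σ →₀ ℕ, d.degree < a → coeff d f = 0)
    (hg : ∀ d : σ →₀ ℕ, d.degree < b → coeff d g = 0) :
    ∀ d : σ →₀ ℕ, d.degree < a + b → coeff d (f * g) = 0 :=
  (degGE_isFilt σ R).2.2.2.2.2 a b f g hf hg

/-- A linear form `Σ_l C (c l) * X l` has total degree `≤ 1` (also over the trivial ring: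
`X l` is homogeneous of degree `1`). -/
theorem totalDegree_linear_le_one [Fintype τ] (c : τ → R) :
    (∑ l, C (c l) * X l : MvPolynomial τ R).totalDegree ≤ 1 :=
  totalDegree_finsetSum_le fun l _ => (totalDegree_mul _ _).trans (by
    simpa using (isHomogeneous_X R l).totalDegree_le)

/-- Substituting polynomials of total degree `≤ 1` does not increase the total degree. -/
theorem totalDegree_aeval_le_of_le_one (f : MvPolynomial σ R) (g : σ → MvPolynomial τ R)
    (hg : ∀ j, (g j).totalDegree ≤ 1) : (aeval g f).totalDegree ≤ f.totalDegree := by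
  rw [aeval_def, eval₂_eq]
  refine totalDegree_finsetSum_le fun d hd => (totalDegree_mul _ _).trans ?_
  rw [algebraMap_eq, totalDegree_C, zero_add]
  refine (totalDegree_finsetProd _ _).trans (le_trans ?_ (le_totalDegree hd))
  rw [Finsupp.sum]
  refine Finset.sum_le_sum fun i _ => (totalDegree_pow _ _).trans ?_
  simpa using Nat.mul_le_mul_left (d i) (hg i)

/-- Composing linear forms: `Σ_j c_j λ_j` with `λ_j = Σ_l M_{jl} X_l` is the linear form with
coefficients `c M`. -/
theorem sum_C_mul_linear [Fintype σ] [Fintype τ] (c : σ → R) (M : σ → τ → R) :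
    ∑ j, C (c j) * (∑ l, C (M j l) * X l : MvPolynomial τ R) = ∑ l, C (∑ j, c j * M j l) * X l := by
  simp only [Finset.mul_sum, map_sum, Finset.sum_mul]
  rw [Finset.sum_comm]
  refine Finset.sum_congr rfl fun l _ => Finset.sum_congr rfl fun j _ => ?_
  rw [map_mul, mul_assoc]

variable [Fintype σ] [DecidableEq σ]

/-- **Affine Taylor expansion modulo degree `≥ 2`.**  Substituting `X_j ↦ y₀_j + λ_j` with `λ_j`
without constant term: `f(y₀ + λ) ≡ f(y₀) + Σ_j (∂_j f)(y₀) λ_j` modulo monomials of degree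
`≥ 2` (proved on `C a`, sums and `p * X n`; no calculus). -/
theorem affineTaylor (y₀ : σ → R) (lam : σ → MvPolynomial τ R)
    (hlam : ∀ j, ∀ d : τ →₀ ℕ, d.degree < 1 → coeff d (lam j) = 0) (f : MvPolynomial σ R) :
    ∀ d : τ →₀ ℕ, d.degree < 2 → coeff d (aeval (fun j => C (y₀ j) + lam j) f -
      (C (eval y₀ f) + ∑ j, C (eval y₀ (pderiv j f)) * lam j)) = 0 := by
  induction f using MvPolynomial.induction_on with
  | C a =>
    have : aeval (fun j => C (y₀ j) + lam j) (C a) -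
        (C (eval y₀ (C a)) + ∑ j, C (eval y₀ (pderiv j (C a))) * lam j) = 0 := by simp
    rw [this]
    exact fun _ _ => coeff_zero _
  | add p q hp hq =>
    have : aeval (fun j => C (y₀ j) + lam j) (p + q) -
        (C (eval y₀ (p + q)) + ∑ j, C (eval y₀ (pderiv j (p + q))) * lam j) =
        (aeval (fun j => C (y₀ j) + lam j) p -
          (C (eval y₀ p) + ∑ j, C (eval y₀ (pderiv j p)) * lam j)) +
        (aeval (fun j => C (y₀ j) + lam j) q -
          (C (eval y₀ q) + ∑ j, C (eval y₀ (pderiv j q)) * lam j)) := by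
      simp only [map_add, add_mul, Finset.sum_add_distrib]
      ring
    rw [this]
    exact (degGE_isFilt τ R).2.1 2 _ _ hp hq
  | mul_X p n hp =>
    set r := aeval (fun j => C (y₀ j) + lam j) p -
      (C (eval y₀ p) + ∑ j, C (eval y₀ (pderiv j p)) * lam j) with hr
    have hsum : ∑ j, C (eval y₀ (pderiv j (p * X n))) * lam j =
        (∑ j, C (eval y₀ (pderiv j p)) * lam j) * C (y₀ n) + C (eval y₀ p) * lam n := by
      simp only [pderiv_mul, pderiv_X, map_add, map_mul, eval_X, add_mul, Finset.sum_add_distrib,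
        Finset.sum_mul]
      congr 1
      · exact Finset.sum_congr rfl fun j _ => by ring
      · rw [Finset.sum_eq_single n]
        · simp
        · intro j _ hj
          simp [Ne.symm hj]
        · simp
    have key : aeval (fun j => C (y₀ j) + lam j) (p * X n) -
        (C (eval y₀ (p * X n)) + ∑ j, C (eval y₀ (pderiv j (p * X n))) * lam j) =
        r * (C (y₀ n) + lam n) + (∑ j, C (eval y₀ (pderiv j p)) * lam j) * lam n := by
      rw [hsum, map_mul, aeval_X, eval_mul, eval_X, map_mul, hr]
      ring
    rw [key]
    refine (degGE_isFilt τ R).2.1 2 _ _ ?_ ?_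
    · simpa using degGE_mul hp
        (show ∀ d : τ →₀ ℕ, d.degree < 0 → coeff d (C (y₀ n) + lam n) = 0 from
          fun d hd => absurd hd (Nat.not_lt_zero _))
    · rw [Finset.sum_mul]
      refine degGE_sum _ fun j _ => ?_
      rw [mul_assoc]
      exact degGE_C_mul _ (degGE_mul (hlam j) (hlam n))

/-- A linear form with coefficients a row of the identity matrix is a variable. -/
theorem linear_eq_X_of_mul_eq_one {J' M : Matrix σ σ R} (hJM : J' * M = 1) (i' : σ) :
    ∑ l, C (∑ j, J' i' j * M j l) * X l = (X i' : MvPolynomial σ R) := by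
  have h : ∀ l, ∑ j, J' i' j * M j l = if i' = l then 1 else 0 := fun l => by
    have := congr_fun (congr_fun hJM i') l
    rwa [Matrix.mul_apply, Matrix.one_apply] at this
  simp_rw [h]
  simp [Finset.sum_ite_eq]

/-- Evaluating a linear form. -/
theorem aeval_linear {A : Type*} [CommRing A] [Algebra R A] [Fintype τ] (x : τ → A) (c : τ → R) :
    aeval x (∑ l, C (c l) * X l) = ∑ l, algebraMap R A (c l) * x l := by
  simp only [map_sum, map_mul, aeval_C, aeval_X]

/-- `M (J' q) = q` for `M J' = 1`, with scalars acting through `algebraMap`. -/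
theorem sum_algebraMap_mul_sum {A : Type*} [CommRing A] [Algebra R A] {J' M : Matrix σ σ R}
    (hMJ : M * J' = 1) (q : σ → A) (j : σ) :
    ∑ l, algebraMap R A (M j l) * ∑ j', algebraMap R A (J' l j') * q j' = q j := by
  have h : ∀ j', ∑ l, M j l * J' l j' = if j = j' then 1 else 0 := fun j' => by
    have := congr_fun (congr_fun hMJ j) j'
    rwa [Matrix.mul_apply, Matrix.one_apply] at this
  simp only [Finset.mul_sum]
  rw [Finset.sum_comm]
  simp_rw [← mul_assoc, ← map_mul, ← Finset.sum_mul, ← map_sum, h]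
  simp [Finset.sum_ite_eq]

end Subst

/-! ## The coordinates theorem -/

/-- **Jet reduction — source coordinates (abstract form).**  See the module docstring: from the
datum `(Γ, p, y₀, T, i₀, M)` over a filtered algebra, quadratic corrections `B, B₀` (no monomials
of degree `< 2`), the linear form `ℓ` and the solution `q̃` of `q̃ = T' - B(q̃)` with
`T_{i₀} = ℓ(q̃) + B₀(q̃)`, and the finisher `ℓ = 0 ∧ B₀ ≡ 0 (mod degree ≥ 3) ⇒ T_{i₀} = 0`. -/
theorem jetReduction_coordinates {R A : Type*} [CommRing R] [CommRing A] [Algebra R A]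
    {F : ℕ → A → Prop}
    (hF : (∀ n, F n 0) ∧ (∀ n x y, F n x → F n y → F n (x + y)) ∧ (∀ n x, F n x → F n (-x)) ∧
      (∀ a b x, a ≤ b → F b x → F a x) ∧ (∀ r, F 0 (algebraMap R A r)) ∧
      (∀ a b x y, F a x → F b y → F (a + b) (x * y)))
    (hconst : ∀ r : R, F 1 (algebraMap R A r) → r = 0)
    {k : ℕ} (Γ : Fin (k + 1) → MvPolynomial (Fin k) R) (hΓ : ∀ i, (Γ i).totalDegree ≤ 2)
    (p : Fin k → A) (y₀ : Fin k → R) (hp : ∀ j, F 1 (p j - algebraMap R A (y₀ j)))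
    (T : Fin (k + 1) → A) (hT : ∀ i, F 1 (T i)) (hsol : ∀ i, aeval p (Γ i) = T i)
    (i₀ : Fin (k + 1)) (M : Matrix (Fin k) (Fin k) R)
    (hJM : (Matrix.of fun i' j => eval y₀ (pderiv j (Γ (i₀.succAbove i')))) * M = 1)
    (hMJ : M * (Matrix.of fun i' j => eval y₀ (pderiv j (Γ (i₀.succAbove i')))) = 1) :
    ∃ (B : Fin k → MvPolynomial (Fin k) R) (B₀ : MvPolynomial (Fin k) R) (ℓ : Fin k → R)
      (q : Fin k → A),
      (∀ j, ∀ d : Fin k →₀ ℕ, d.degree < 2 → coeff d (B j) = 0) ∧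
      (∀ d : Fin k →₀ ℕ, d.degree < 2 → coeff d B₀ = 0) ∧
      (∀ j, F 1 (q j)) ∧ (∀ j, q j = T (i₀.succAbove j) - aeval q (B j)) ∧
      T i₀ = ∑ j, algebraMap R A (ℓ j) * q j + aeval q B₀ ∧
      ((∀ j, ℓ j = 0) → (∀ d : Fin k →₀ ℕ, d.degree < 3 → coeff d B₀ = 0) → T i₀ = 0) := by
  -- the derived objects
  set J' : Matrix (Fin k) (Fin k) R :=
    Matrix.of fun i' j => eval y₀ (pderiv j (Γ (i₀.succAbove i')))
  set lam : Fin k → MvPolynomial (Fin k) R := fun j => ∑ l, C (M j l) * X l with hlam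
  set Lin : Fin (k + 1) → MvPolynomial (Fin k) R :=
    fun i => ∑ j, C (eval y₀ (pderiv j (Γ i))) * lam j with hLin
  set Γt : Fin (k + 1) → MvPolynomial (Fin k) R := fun i => aeval (fun j => C (y₀ j) + lam j) (Γ i)
    with hΓt
  set q : Fin k → A := fun j => p j - algebraMap R A (y₀ j) with hq
  set qt : Fin k → A := fun i' => ∑ j, algebraMap R A (J' i' j) * q j with hqt
  set ℓ : Fin k → R := fun l => ∑ j, eval y₀ (pderiv j (Γ i₀)) * M j l
  -- degrees
  have lam_mem : ∀ j, ∀ d : Fin k →₀ ℕ, d.degree < 1 → coeff d (lam j) = 0 := fun j =>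
    degGE_sum _ fun l _ => degGE_C_mul _ (degGE_X l)
  have Lin_mem : ∀ i, ∀ d : Fin k →₀ ℕ, d.degree < 1 → coeff d (Lin i) = 0 := fun i =>
    degGE_sum _ fun j _ => degGE_C_mul _ (lam_mem j)
  have taylor : ∀ i, ∀ d : Fin k →₀ ℕ, d.degree < 2 →
      coeff d (Γt i - (C (eval y₀ (Γ i)) + Lin i)) = 0 := fun i =>
    affineTaylor y₀ lam lam_mem (Γ i)
  -- the solution in the new coordinates
  have q_mem : ∀ j, F 1 (q j) := hp
  have qt_mem : ∀ i', F 1 (qt i') := fun i' =>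
    filt_sum hF _ _ fun j _ => filt_algebraMap_mul hF _ (q_mem j)
  have aeval_qt_phi : ∀ j, aeval qt (C (y₀ j) + lam j) = p j := fun j => by
    rw [map_add, aeval_C, hlam, aeval_linear, hqt]
    simp only
    rw [sum_algebraMap_mul_sum hMJ q j, hq]
    simp only [add_sub_cancel]
  have aeval_qt_Γt : ∀ i, aeval qt (Γt i) = T i := fun i => by
    rw [hΓt]
    simp only
    rw [aeval_aeval]
    simp_rw [aeval_qt_phi]
    exact hsol i
  -- Γ(y₀) = 0, read to level 1
  have eval_y₀ : ∀ i, eval y₀ (Γ i) = 0 := fun i => by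
    apply hconst
    have h1 : F 1 (aeval qt (Γt i - (C (eval y₀ (Γ i)) + Lin i))) :=
      hF.2.2.2.1 1 2 _ one_le_two (filt_aeval hF (taylor i) qt_mem)
    have h2 : F 1 (aeval qt (Lin i)) := filt_aeval hF (Lin_mem i) qt_mem
    have h3 := filt_sub hF (filt_sub hF (hT i) h1) h2
    rw [map_sub, map_add, aeval_C, aeval_qt_Γt] at h3
    convert h3 using 1
    ring
  have Bt_mem : ∀ i, ∀ d : Fin k →₀ ℕ, d.degree < 2 → coeff d (Γt i - Lin i) = 0 := fun i => by
    have := taylor i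
    rwa [eval_y₀ i, C_0, zero_add] at this
  -- the linear parts
  have Lin_eq : ∀ i, Lin i = ∑ l, C (∑ j, eval y₀ (pderiv j (Γ i)) * M j l) * X l := fun i => by
    rw [hLin, hlam]
    exact sum_C_mul_linear _ _
  have Lin_succAbove : ∀ i', Lin (i₀.succAbove i') = X i' := fun i' => by
    rw [Lin_eq]
    exact linear_eq_X_of_mul_eq_one hJM i'
  have Lin_i₀ : Lin i₀ = ∑ l, C (ℓ l) * X l := Lin_eq i₀
  -- total degree of the quadratic part at i₀
  have deg_B₀ : (Γt i₀ - Lin i₀).totalDegree ≤ 2 := by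
    refine (totalDegree_sub _ _).trans (max_le ?_ ?_)
    · refine (totalDegree_aeval_le_of_le_one _ _ fun j => ?_).trans (hΓ i₀)
      exact (totalDegree_add _ _).trans (max_le (by simp) (totalDegree_linear_le_one _))
    · rw [Lin_i₀]; exact (totalDegree_linear_le_one _).trans one_le_two
  refine ⟨fun i' => Γt (i₀.succAbove i') - Lin (i₀.succAbove i'), Γt i₀ - Lin i₀, ℓ, qt,
    fun i' => Bt_mem _, Bt_mem _, qt_mem, fun i' => ?_, ?_, fun hℓ0 hB₀ => ?_⟩
  · -- the fixed-point equation
    have := aeval_qt_Γt (i₀.succAbove i')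
    have e : Γt (i₀.succAbove i') =
        X i' + (Γt (i₀.succAbove i') - Lin (i₀.succAbove i')) := by rw [Lin_succAbove]; ring
    rw [e, map_add, aeval_X] at this
    linear_combination this
  · -- T i₀ = ℓ(q̃) + B₀(q̃)
    have := aeval_qt_Γt i₀
    have e : Γt i₀ = ∑ l, C (ℓ l) * X l + (Γt i₀ - Lin i₀) := by rw [Lin_i₀]; ring
    rw [e, map_add, aeval_linear] at this
    exact this.symm
  · -- the finisher
    have hB₀0 : Γt i₀ - Lin i₀ = 0 := by
      ext d
      rw [coeff_zero]
      by_cases hd : d.degree < 3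
      · exact hB₀ d hd
      · exact coeff_eq_zero_of_totalDegree_lt (by rw [← Finsupp.degree_apply]; omega)
    rw [← aeval_qt_Γt i₀, show Γt i₀ = Lin i₀ + (Γt i₀ - Lin i₀) by ring, hB₀0, Lin_i₀]
    simp [hℓ0]

end JetReduction

/-- **Jet reduction, part 3 — source coordinates in `ℂ((t))`** (helper of the stub
`stub_jetReduction`): `jetReduction_coordinates` for `A = ℂ((t))` filtered `t`-adically (level
`1` = positive order, which contains no nonzero constant). -/
theorem jetReduction_coordinatesLaurent :
    ∀ (k : ℕ) (Γ : Fin (k + 1) → MvPolynomial (Fin k) ℂ) (p : Fin k → LaurentSeries ℂ)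
      (y₀ : Fin k → ℂ) (T : Fin (k + 1) → LaurentSeries ℂ) (i₀ : Fin (k + 1))
      (M : Matrix (Fin k) (Fin k) ℂ), (∀ i, (Γ i).totalDegree ≤ 2) →
      (∀ j, ∀ g : ℤ, g < (1 : ℕ) → (p j - algebraMap ℂ (LaurentSeries ℂ) (y₀ j)).coeff g = 0) →
      (∀ i, ∀ g : ℤ, g < (1 : ℕ) → (T i).coeff g = 0) →
      (∀ i, MvPolynomial.aeval p (Γ i) = T i) →
      (Matrix.of fun i' j => MvPolynomial.eval y₀
        (MvPolynomial.pderiv j (Γ (i₀.succAbove i')))) * M = 1 →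
      M * (Matrix.of fun i' j => MvPolynomial.eval y₀
        (MvPolynomial.pderiv j (Γ (i₀.succAbove i')))) = 1 →
      ∃ (B : Fin k → MvPolynomial (Fin k) ℂ) (B₀ : MvPolynomial (Fin k) ℂ) (ℓ : Fin k → ℂ)
        (q : Fin k → LaurentSeries ℂ),
        (∀ j, ∀ d : Fin k →₀ ℕ, d.degree < 2 → MvPolynomial.coeff d (B j) = 0) ∧
        (∀ d : Fin k →₀ ℕ, d.degree < 2 → MvPolynomial.coeff d B₀ = 0) ∧
        (∀ j, ∀ g : ℤ, g < (1 : ℕ) → (q j).coeff g = 0) ∧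
        (∀ j, q j = T (i₀.succAbove j) - MvPolynomial.aeval q (B j)) ∧
        T i₀ = ∑ j, algebraMap ℂ (LaurentSeries ℂ) (ℓ j) * q j + MvPolynomial.aeval q B₀ ∧
        ((∀ j, ℓ j = 0) → (∀ d : Fin k →₀ ℕ, d.degree < 3 → MvPolynomial.coeff d B₀ = 0) →
          T i₀ = 0) :=
  fun _ Γ p y₀ T i₀ M hΓ hp hT hsol hJM hMJ =>
    JetReduction.jetReduction_coordinates
      (F := fun m (z : LaurentSeries ℂ) => ∀ g : ℤ, g < m → z.coeff g = 0)
      JetReduction.laurentGE_isFilt (fun r hr => by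
        have := hr 0 (by norm_num)
        rwa [AffinePeeling.algebraMap_laurentSeries_apply, HahnSeries.coeff_single_same] at this)
      Γ hΓ p y₀ hp T hT hsol i₀ M hJM hMJ

end Summit.ValiantsHypothesis.ValiantsHypothesis.Theorems.BinomialCandidateStubs
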